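import Summits.HodgeConjecture.HodgeConjecture.Theorems.HodgeAbelianVarieties.Negative.ExtremeCodimensions

/-!
# `AbelianAnchorAssembly` (stmt-HodgeConjecture-14913) — logical status of the abelian glue node

Route `PadicSemiregularLift`, support item
`AbelianAnchorAssembly := HodgeLocusPropagation → FormalLiftingFromClassLifting →
FormalVectorBundlesAlgebraize → HodgeAbelianVarieties` ("granted the typed engine P2c, P1a, P3a, the
Hodge conjecture holds for every complex abelian variety").

This file records, kernel-checked and UNCONDITIONALLY (every bundled abelian variety is smooth projective of
dimension `A.dim`: `AbelianVariety.isSmoothProjective_holds`, PROVED in the tree), where the node sits: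

* `abelianAnchorAssembly_iff_of_engine`: granted the three engine items, the node is LITERALLY the crux
  `HodgeAbelianVarieties` (stmt-HodgeConjecture-1333) — it is weaker than the crux only by the engine;
* `abelianAnchorAssembly_of_hodgeConjecture` / `not_hodgeConjecture_of_not_abelianAnchorAssembly`: the node
  follows from the summit statement, so it is not refutable unless `HodgeConjecture` is;
* `abelianAnchorAssembly_iff_middle_of_engine`: granted the engine, the node is the anti-vacuity conjunct plus
  the cycle part of HC on abelian varieties in the MIDDLE codimensions `1 ≤ p < dim A` — the degrees in which
  the route's seed statement (`StarSeedsFor`, skeleton `Cruxes/HodgeAbelianVarieties/Lines/inner-form-invariant-seeds.lean`)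
  is asked.

The genuine proof of the node inside the route is the skeleton's composition `HodgeAbelianVarieties_of`
modulo its two stubs `InnerFormAnchors` (true in print) and `StarSeeds` (open; HC-equivalent at the line's
own anchors, Glue IV ibid.) and the fact `nonempty_hodgeModel`; it is to be appended here once the
vocabulary module `PadicSemiregularLiftAnchorDefs` (definition item `defn-PadicSemiregularLiftAnchorDefs`)
is importable.
-/

set_option linter.dupNamespace false

noncomputable section

namespace Summit.HodgeConjecture.HodgeConjecture.Theorems

open Summit.HodgeConjecture.HodgeConjecture.Theses.PadicSemiregularLift
open Literature.AlgebraicGeometry Literature.AlgebraicGeometry.HodgeTheory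
  Literature.AlgebraicGeometry.Motives Literature.AlgebraicTopology.SingularHomology

/-- **Upper bread**: the crux `HodgeAbelianVarieties` (HC for complex abelian varieties) gives the node
outright, ignoring the engine. [folklore] -/
theorem abelianAnchorAssembly_of_hodgeAbelianVarieties (h : HodgeAbelianVarieties) :
    AbelianAnchorAssembly :=
  fun _ _ _ => h

/-- **Lower bread**: the node together with the three engine items P2c `HodgeLocusPropagation`, P1a
`FormalLiftingFromClassLifting`, P3a `FormalVectorBundlesAlgebraize` gives the crux (modus ponens).
[folklore] -/
theorem hodgeAbelianVarieties_of_abelianAnchorAssembly (h : AbelianAnchorAssembly)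
    (hP : HodgeLocusPropagation) (h1a : FormalLiftingFromClassLifting)
    (h3a : FormalVectorBundlesAlgebraize) : HodgeAbelianVarieties :=
  h hP h1a h3a

/-- **Granted the engine, the node IS the crux `HodgeAbelianVarieties`** (stmt-HodgeConjecture-1333): its
content beyond the three engine items is exactly the Hodge conjecture for complex abelian varieties.
[folklore] -/
theorem abelianAnchorAssembly_iff_of_engine (hP : HodgeLocusPropagation)
    (h1a : FormalLiftingFromClassLifting) (h3a : FormalVectorBundlesAlgebraize) :
    AbelianAnchorAssembly ↔ HodgeAbelianVarieties :=
  ⟨fun h => h hP h1a h3a, fun h _ _ _ => h⟩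

/-- **The node follows from the summit statement** — unconditionally, because every bundled complex
abelian variety is smooth projective of dimension `A.dim` (`AbelianVariety.isSmoothProjective_holds`,
Görtz–Wedhorn II Thm. 27.71 / Prop. 27.174, PROVED in the tree), so the smooth-projectivity guard of
`HodgeConjecture` is automatic on the binder of `HodgeAbelianVarieties`.
[cite: GortzWedhorn2023, Prop. 27.174 (p. 880)] -/
theorem abelianAnchorAssembly_of_hodgeConjecture (hc : _root_.HodgeConjecture) :
    AbelianAnchorAssembly :=
  abelianAnchorAssembly_of_hodgeAbelianVarieties
    (HodgeAbelianVarieties.Negative.iff_hodgeConjecture_restricted.2 fun _ hA => hc hA)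

/-- **Any refutation of the node refutes the Hodge conjecture** (contrapositive of
`abelianAnchorAssembly_of_hodgeConjecture`): `¬ AbelianAnchorAssembly` unfolds to "the three engine
items hold and HC fails for some complex abelian variety". [folklore] -/
theorem not_hodgeConjecture_of_not_abelianAnchorAssembly (h : ¬ AbelianAnchorAssembly) :
    ¬ _root_.HodgeConjecture :=
  fun hc => h (abelianAnchorAssembly_of_hodgeConjecture hc)

/-- **Granted the engine, the node is the anti-vacuity conjunct plus the MIDDLE codimensions**
`1 ≤ p < dim A` of the cycle part of HC on abelian varieties (the extreme codimensions `p = 0`,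
`p ≥ dim A` are algebraic unconditionally, `HodgeAbelianVarieties.Negative.mem_algebraicClasses_of_dim_le`).
These are exactly the degrees `1 ≤ r < d` in which the route's seed statement `StarSeedsFor` is asked.
[cite: VoisinHodgeII2003, §10.2.3 proof of Prop. 10.26] -/
theorem abelianAnchorAssembly_iff_middle_of_engine (hP : HodgeLocusPropagation)
    (h1a : FormalLiftingFromClassLifting) (h3a : FormalVectorBundlesAlgebraize) :
    AbelianAnchorAssembly ↔
      ∀ A : AbelianVariety ℂ, Nonempty (HodgeModel A.dim A.X) ∧
        ∀ p : ℕ, 1 ≤ p → p < A.dim →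
          ∀ c : singularCohomology ℂ ℂ (ComplexPoints A.X) (2 * p), IsRationalClass c →
            IsOfHodgeType A.dim A.X (2 * p) p p c → c ∈ algebraicClasses A.X p := by
  rw [abelianAnchorAssembly_iff_of_engine hP h1a h3a]
  exact HodgeAbelianVarieties.Negative.hodgeAbelianVarieties_iff_middle

/-- **Granted the engine and the Hodge-model fact** (`nonempty_hodgeModel`, Serre GAGA + de Rham + Hodge
decomposition, a named fact of the tree), the node is exactly the cycle part of HC on abelian varieties
in the middle codimensions. [cite: Deligne2000, §1] -/
theorem abelianAnchorAssembly_iff_middleCyclePart_of_engine (hP : HodgeLocusPropagation)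
    (h1a : FormalLiftingFromClassLifting) (h3a : FormalVectorBundlesAlgebraize)
    (hM : ∀ (n : ℕ) (X : SchemeOver ℂ), nonempty_hodgeModel n X) :
    AbelianAnchorAssembly ↔
      ∀ (A : AbelianVariety ℂ) (p : ℕ), 1 ≤ p → p < A.dim →
        ∀ c : singularCohomology ℂ ℂ (ComplexPoints A.X) (2 * p), IsRationalClass c →
          IsOfHodgeType A.dim A.X (2 * p) p p c → c ∈ algebraicClasses A.X p := by
  rw [abelianAnchorAssembly_iff_middle_of_engine hP h1a h3a]
  exact ⟨fun h A p h1 hp c hc hpp => (h A).2 p h1 hp c hc hpp,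
    fun h A => ⟨hM _ _ (AbelianVariety.isSmoothProjective_holds (A := A)), h A⟩⟩

/-- **The degenerate end of the binder is reached and harmless**: granted the engine and the Hodge-model
fact, the node holds at every abelian variety of dimension `≤ 1` (no middle codimension exists).
[folklore] -/
theorem abelianAnchorAssembly_inst_of_dim_le_one
    (hM : ∀ (n : ℕ) (X : SchemeOver ℂ), nonempty_hodgeModel n X)
    (A : AbelianVariety ℂ) (hA : A.dim ≤ 1) : HodgeConjectureFor A.dim A.X := by
  refine ⟨hM _ _ (AbelianVariety.isSmoothProjective_holds (A := A)), fun p c _ _ => ?_⟩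
  exact HodgeAbelianVarieties.Negative.mem_algebraicClasses_of_dim_le A (by omega) c

end Summit.HodgeConjecture.HodgeConjecture.Theorems

end
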